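import Summits.NavierStokesRegularity.OSWSelfSimilar.SheetRTranslationModeAssembly
import Summits.NavierStokesRegularity.OSWSelfSimilar.SheetRCentreOfRecordValue
import Summits.NavierStokesRegularity.OSWSelfSimilar.SheetRFrameCentreResidual
import HarnessLib

/-!
# SHEET-ℝ, EVEN half of Z3-SR-SPEC: (PO-2) ∧ (PO-3) FOR THE CENTRE OF RECORD — the translation mode of THE profile of record
# `Ω* = centreOfRecord + prim (der δ)` is an `E⁺₀`-eigenvector of `−DG⁺(Ω*)` for `σ = ½`, modulo only the Newton–Kantorovich row

HONEST FRAMING (cell ns-blowup GROUP B / zone Z3, cases Z3-SR-CERT + Z3-SR-SPEC EVEN half; 1-D MODEL certificate (viscous gCLM/OSW sheet on the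
line at `(a, c_l, ε) = (1/5, 1/2, 1)`); computer-assisted; not Euler/NS; «violates: none — MODEL»).  `SheetRTranslationModeAssembly.translationMode_certified`
(cert-1 g8) states the even items PO-2 ∧ PO-3 for `Ω* := Ω̄ + prim (der δ)` over an ABSTRACT centre `hc : IsCentre 8 Ω̄ Ω̄₁ H₀` with `Ω̄₁ ∈ C¹` and
`|Ω̄(X₀)| > (√2/8)·rEBR2`.  With selfsim g13's TYPED centre of record (`SheetRCentreOfRecord.centreOfRecord` = cert-1's JSON centre
`c4de65e13d80c930` by `SheetRCentreOfRecordSine.centreOfRecord_eq_sineForm`) those three «which centre» hypotheses are KERNEL FACTS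
(`isCentre_centreOfRecord`, `contDiff_centreOfRecordDeriv`, `rEBR2_lt_abs_centreOfRecord_eight` at `X₀ = 8`), exactly as in selfsim's odd-class
`SheetRCertifiedProfileOfRecord.certifiedProfile_word_ofRecord`.  THIS FILE is the even companion of that instantiation:
* §1 `translationMode_certified_ofRecord`: for every `δ` in the `rEBR2`-ball solving the linearised weak equation at `centreOfRecord` (and the weighted
  square-integrability `hG` of the centre's residual): `Ω* = centreOfRecord + prim (der δ)` is a centre, `Ω* ∈ C³`, `DG⁺(Ω*)[Ω*′] = −½Ω*′` pointwise
  (covariant gauge), `Ω*′ ∈ E⁺₀` (even, `∫(64+ξ²)(Ω*′² + Ω*″²) < ∞`, `∫Ω*′ = 0`), `Ω*′ ≢ 0`.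
* §2 `translationMode_word_ofRecord`: the same PACKAGED with the existence row (`SheetRCertificateAssemblyB.existsUnique_weakSolutionB`, implementation 2's
  constants `KNwB`/`epsNBR`/`etaB2`): modulo EXACTLY the Newton–Kantorovich hypotheses of record about DEFINED objects — (C1) pointwise datum `hC1`, base
  solution operator `S₀`/`hS₀`, capacitance inverse `Nmat` with `hN₁ hN₂ hKNwB hepsNB`, residual `hG`/`hηB` (hypothesis-ledger rows #3–#8) — there is
  EXACTLY ONE `δ` in the `rEBR2`-ball solving the linearised weak equation, and for `Ω* = centreOfRecord + prim (der δ)`: «`σ = ½` IS an eigenvalue of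
  `−DG⁺(Ω*)` in the covariant gauge, with the non-trivial eigenvector `Ω*′ ∈ E⁺₀`».  NO spectral hypothesis ((S1) Gårding datum, point records, far
  datum) enters: the EXISTENCE half of the even word «translation gauge σ = ½» is kernel modulo the NK row alone; what the S2⁺ winding certificate
  (`CertificateViscousSheetRSpectrumEven`, `SheetRSpectrumEvenWindingLists`) adds is «and nothing else in D⁺», whose identification step ((P5) for the
  even Evans function) stays PAPER.
No definition, no named fact; one-line instantiations.  WHAT THIS IS NOT: not NS; no interval sentence is proved here; no number of record moves.
-/

noncomputable section

namespace Summit.NavierStokesRegularity.OSWSelfSimilar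
namespace SheetRTranslationModeOfRecord

open _root_.MeasureTheory _root_.Set _root_.Filter _root_.Real _root_.Metric Literature.Analysis.Fourier Literature.Analysis.OperatorTheory
  SheetREnergySpace SheetRLinearisedTests SheetRLinearisedFormBounds SheetRSolutionOperator SheetRAssemblyOperators SheetRCertificateAssembly
  SheetRCertificateAssemblyB SheetRSpectrumCertifiedProfile SheetRTranslationModeAssembly SheetRFrameCentre SheetRCentreOfRecord
  SheetRCentreOfRecordValue CertificateViscousSheetR Matrix Finset
open scoped Topology ENNReal ContDiff BigOperators

/-! ### §1 For a weak solution in the ball, at the centre of record -/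

/-- **(PO-2) ∧ (PO-3) FOR THE CENTRE OF RECORD.** For every `δ` in the `rEBR2`-ball solving the linearised weak equation at `Ω̄ := centreOfRecord`
(given the weighted square-integrability `hG` of the centre's residual): `Ω* = centreOfRecord + prim (der δ)` is a centre, lies in `C³`, its translation
mode `Ω*′` satisfies `DG⁺(Ω*)[Ω*′] = −½·Ω*′` at every point (translation-covariant gauge; `σ = ½` is an exact eigenvalue of `−DG⁺(Ω*)`), is EVEN with
`∫(64+ξ²)Ω*′² < ∞`, `∫(64+ξ²)Ω*″² < ∞`, `∫Ω*′ = 0` (`Ω*′ ∈ E⁺₀`), and `Ω*′ ≢ 0`.  `translationMode_certified` with hypothesis-ledger rows #1, #2, #9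
discharged by `isCentre_centreOfRecord`, `contDiff_centreOfRecordDeriv`, `rEBR2_lt_abs_centreOfRecord_eight` (`X₀ = 8`).  MODEL statement; not NS. [folklore] -/
theorem translationMode_certified_ofRecord
    (hG : Integrable fun y => ((8:ℝ) ^ 2 + y ^ 2) * (centreOfRecord y + 1 / 2 * y * centreOfRecordDeriv y
      + 1 / 5 * (∫ s in (0 : ℝ)..y, hilbertTransform centreOfRecord s) * centreOfRecordDeriv y
      - hilbertTransform centreOfRecord y * centreOfRecord y - deriv centreOfRecordDeriv y) ^ 2)
    (δ : Esp 8 eight_pos) (hball : δ ∈ closedBall (0 : Esp 8 eight_pos) (rEBR2 : ℝ))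
    (hlin : ∀ v v₁ : ℝ → ℝ, IsCompactTest v v₁ →
      linForm 8 (drift (1 / 5) centreOfRecord) (potential 8 4 centreOfRecord) (prim (der δ)) (der δ) v v₁ =
        ∫ y, ((8:ℝ) ^ 2 + y ^ 2) * ((PopFun 8 4 (1 / 5) centreOfRecord centreOfRecordDeriv δ y
          - (centreOfRecord y + 1 / 2 * y * centreOfRecordDeriv y
            + 1 / 5 * (∫ s in (0 : ℝ)..y, hilbertTransform centreOfRecord s) * centreOfRecordDeriv y
            - hilbertTransform centreOfRecord y * centreOfRecord y - deriv centreOfRecordDeriv y)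
          - QFun 8 (1 / 5) δ δ y) * v y)) :
    ∃ (Ωs₁ : ℝ → ℝ) (Hs : ℝ), IsCentre 8 (fun y => centreOfRecord y + prim (der δ) y) Ωs₁ Hs ∧
      ContDiff ℝ 3 (fun y => centreOfRecord y + prim (der δ) y) ∧
      (∀ X, deriv (fun y => centreOfRecord y + prim (der δ) y) X
          + 1 / 2 * X * deriv (deriv (fun y => centreOfRecord y + prim (der δ) y)) X
          + 1 / 5 * (hilbertTransform (fun y => centreOfRecord y + prim (der δ) y) X
              * deriv (fun y => centreOfRecord y + prim (der δ) y) X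
            + (∫ s in (0 : ℝ)..X, hilbertTransform (fun y => centreOfRecord y + prim (der δ) y) s)
              * deriv (deriv (fun y => centreOfRecord y + prim (der δ) y)) X)
          - hilbertTransform (deriv (fun y => centreOfRecord y + prim (der δ) y)) X * (centreOfRecord X + prim (der δ) X)
          - hilbertTransform (fun y => centreOfRecord y + prim (der δ) y) X * deriv (fun y => centreOfRecord y + prim (der δ) y) X
          - 1 * iteratedDeriv 2 (deriv (fun y => centreOfRecord y + prim (der δ) y)) X
        = -(1 / 2) * deriv (fun y => centreOfRecord y + prim (der δ) y) X) ∧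
      (∀ y, deriv (fun y => centreOfRecord y + prim (der δ) y) (-y) = deriv (fun y => centreOfRecord y + prim (der δ) y) y) ∧
      (Integrable fun y => ((8:ℝ) ^ 2 + y ^ 2) * deriv (fun y => centreOfRecord y + prim (der δ) y) y ^ 2) ∧
      (Integrable fun y => ((8:ℝ) ^ 2 + y ^ 2) * deriv (deriv (fun y => centreOfRecord y + prim (der δ) y)) y ^ 2) ∧
      (∫ y, deriv (fun y => centreOfRecord y + prim (der δ) y) y = 0) ∧
      ∃ X, deriv (fun y => centreOfRecord y + prim (der δ) y) X ≠ 0 :=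
  translationMode_certified isCentre_centreOfRecord (contDiff_centreOfRecordDeriv (k := 1)) hG δ hball hlin
    rEBR2_lt_abs_centreOfRecord_eight

/-! ### §2 Packaged with the existence row (implementation 2's Newton–Kantorovich constants) -/

/-- **THE EVEN EXISTENCE WORD FOR THE CENTRE OF RECORD: «`σ = ½` IS an eigenvalue of `−DG⁺(Ω*)` with eigenvector `Ω*′ ∈ E⁺₀`».**  Under the
Newton–Kantorovich hypotheses of record about the DEFINED centre (`centreOfRecord`, `centreOfRecordDeriv`) — the (C1) pointwise datum `hC1`, the base
solution operator `S₀` (`hS₀`), the capacitance inverse `Nmat` with implementation 2's bounds `KNwB`/`epsNBR` (`hN₁ hN₂ hKNwB hepsNB`), the weighted residual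
(`hG`) with its bound `etaB2` (`hηB`) — there is EXACTLY ONE `δ` in the `rEBR2`-ball solving the linearised weak equation at `centreOfRecord`
(`existsUnique_weakSolutionB`), and for `Ω* = centreOfRecord + prim (der δ)`: `Ω*` is a centre in `C³`, `DG⁺(Ω*)[Ω*′] = −½Ω*′` pointwise (covariant
gauge), `Ω*′ ∈ E⁺₀` (even, weighted `H¹`, zero mass), `Ω*′ ≢ 0`.  No spectral hypothesis is used.  MODEL statement; not NS. [folklore] -/
theorem translationMode_word_ofRecord
    (hC1 : ∀ ξ, ((8:ℝ) ^ 2 + ξ ^ 2) / 2 + 1 + ξ ^ 2 / 2 + 1 / 5 * ξ * (∫ s in (0 : ℝ)..ξ, hilbertTransform centreOfRecord s)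
      + (1 / 5) / 2 * ((8:ℝ) ^ 2 + ξ ^ 2) * hilbertTransform centreOfRecord ξ ≤ ((8:ℝ) ^ 2 + ξ ^ 2) * potential 8 4 centreOfRecord ξ)
    (S₀ : W 8 →L[ℝ] Esp 8 eight_pos)
    (hS₀ : ∀ (g : W 8) (v v₁ : ℝ → ℝ), IsCompactTest v v₁ →
      linForm 8 (drift (1 / 5) centreOfRecord) (potential 8 4 centreOfRecord) (prim (der (S₀ g))) (der (S₀ g)) v v₁
        = ∫ y, ((8:ℝ) ^ 2 + y ^ 2) * ((g : ℝ → ℝ) y * v y))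
    {n : ℕ} (f : Fin n → W 8) (ℓ : Fin n → Esp 8 eight_pos →L[ℝ] ℝ) (Nmat : Matrix (Fin n) (Fin n) ℝ)
    (hN₁ : (1 - capMatrix (fun i => S₀ (f i)) ℓ) * Nmat = 1) (hN₂ : Nmat * (1 - capMatrix (fun i => S₀ (f i)) ℓ) = 1)
    (hKNwB : ∀ g : W 8, ‖capInverse (fun i => S₀ (f i)) ℓ Nmat (S₀ g)‖ ≤ (KNwB : ℝ) * ‖g‖)
    (hepsNB : ∀ u : Esp 8 eight_pos, ‖PopC eight_pos 4 (1 / 5) isCentre_centreOfRecord u - ∑ i, ℓ i u • f i‖ ≤ (epsNBR : ℝ) * ‖u‖)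
    (hG : Integrable fun y => ((8:ℝ) ^ 2 + y ^ 2) * (centreOfRecord y + 1 / 2 * y * centreOfRecordDeriv y
      + 1 / 5 * (∫ s in (0 : ℝ)..y, hilbertTransform centreOfRecord s) * centreOfRecordDeriv y
      - hilbertTransform centreOfRecord y * centreOfRecord y - deriv centreOfRecordDeriv y) ^ 2)
    (hηB : Real.sqrt (∫ y, ((8:ℝ) ^ 2 + y ^ 2) * (centreOfRecord y + 1 / 2 * y * centreOfRecordDeriv y
      + 1 / 5 * (∫ s in (0 : ℝ)..y, hilbertTransform centreOfRecord s) * centreOfRecordDeriv y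
      - hilbertTransform centreOfRecord y * centreOfRecord y - deriv centreOfRecordDeriv y) ^ 2) ≤ (etaB2 : ℝ)) :
    ∃ δ : Esp 8 eight_pos, δ ∈ closedBall (0 : Esp 8 eight_pos) (rEBR2 : ℝ) ∧
      (∀ v v₁ : ℝ → ℝ, IsCompactTest v v₁ →
        linForm 8 (drift (1 / 5) centreOfRecord) (potential 8 4 centreOfRecord) (prim (der δ)) (der δ) v v₁ =
          ∫ y, ((8:ℝ) ^ 2 + y ^ 2) * ((PopFun 8 4 (1 / 5) centreOfRecord centreOfRecordDeriv δ y
            - (centreOfRecord y + 1 / 2 * y * centreOfRecordDeriv y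
              + 1 / 5 * (∫ s in (0 : ℝ)..y, hilbertTransform centreOfRecord s) * centreOfRecordDeriv y
              - hilbertTransform centreOfRecord y * centreOfRecord y - deriv centreOfRecordDeriv y)
            - QFun 8 (1 / 5) δ δ y) * v y)) ∧
      (∀ δ' ∈ closedBall (0 : Esp 8 eight_pos) (rEBR2 : ℝ),
        (∀ v v₁ : ℝ → ℝ, IsCompactTest v v₁ →
          linForm 8 (drift (1 / 5) centreOfRecord) (potential 8 4 centreOfRecord) (prim (der δ')) (der δ') v v₁ =
            ∫ y, ((8:ℝ) ^ 2 + y ^ 2) * ((PopFun 8 4 (1 / 5) centreOfRecord centreOfRecordDeriv δ' y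
              - (centreOfRecord y + 1 / 2 * y * centreOfRecordDeriv y
                + 1 / 5 * (∫ s in (0 : ℝ)..y, hilbertTransform centreOfRecord s) * centreOfRecordDeriv y
                - hilbertTransform centreOfRecord y * centreOfRecord y - deriv centreOfRecordDeriv y)
              - QFun 8 (1 / 5) δ' δ' y) * v y)) → δ' = δ) ∧
      ∃ (Ωs₁ : ℝ → ℝ) (Hs : ℝ), IsCentre 8 (fun y => centreOfRecord y + prim (der δ) y) Ωs₁ Hs ∧
        ContDiff ℝ 3 (fun y => centreOfRecord y + prim (der δ) y) ∧
        (∀ X, deriv (fun y => centreOfRecord y + prim (der δ) y) X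
            + 1 / 2 * X * deriv (deriv (fun y => centreOfRecord y + prim (der δ) y)) X
            + 1 / 5 * (hilbertTransform (fun y => centreOfRecord y + prim (der δ) y) X
                * deriv (fun y => centreOfRecord y + prim (der δ) y) X
              + (∫ s in (0 : ℝ)..X, hilbertTransform (fun y => centreOfRecord y + prim (der δ) y) s)
                * deriv (deriv (fun y => centreOfRecord y + prim (der δ) y)) X)
            - hilbertTransform (deriv (fun y => centreOfRecord y + prim (der δ) y)) X * (centreOfRecord X + prim (der δ) X)
            - hilbertTransform (fun y => centreOfRecord y + prim (der δ) y) X * deriv (fun y => centreOfRecord y + prim (der δ) y) X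
            - 1 * iteratedDeriv 2 (deriv (fun y => centreOfRecord y + prim (der δ) y)) X
          = -(1 / 2) * deriv (fun y => centreOfRecord y + prim (der δ) y) X) ∧
        (∀ y, deriv (fun y => centreOfRecord y + prim (der δ) y) (-y) = deriv (fun y => centreOfRecord y + prim (der δ) y) y) ∧
        (Integrable fun y => ((8:ℝ) ^ 2 + y ^ 2) * deriv (fun y => centreOfRecord y + prim (der δ) y) y ^ 2) ∧
        (Integrable fun y => ((8:ℝ) ^ 2 + y ^ 2) * deriv (deriv (fun y => centreOfRecord y + prim (der δ) y)) y ^ 2) ∧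
        (∫ y, deriv (fun y => centreOfRecord y + prim (der δ) y) y = 0) ∧
        ∃ X, deriv (fun y => centreOfRecord y + prim (der δ) y) X ≠ 0 := by
  obtain ⟨δ, ⟨hball, hlin⟩, huniq⟩ := existsUnique_weakSolutionB isCentre_centreOfRecord (contDiff_centreOfRecordDeriv (k := 1)) hC1 S₀ hS₀
    f ℓ Nmat hN₁ hN₂ hKNwB hepsNB hG hηB
  exact ⟨δ, hball, hlin, fun δ' h1 h2 => huniq δ' ⟨h1, h2⟩, translationMode_certified_ofRecord hG δ hball hlin⟩

/-! ### §3 (APPEND, same seat) Row #8's integrability half DISCHARGED: the same two theorems without the `hG` binder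

`SheetRFrameCentreResidual.integrable_weight_residual_sq_centreOfRecord` (cert-1 g8) proves the weighted square-integrability of the
centre of record's residual, so the `hG` hypothesis of §1/§2 is supplied by the kernel: the even existence word for the objects of record
now rests on INTERVAL SENTENCES ONLY (NK rows #3–#7 and the interval half `hηB` of #8). -/

/-- **§1 without `hG`.** `translationMode_certified_ofRecord` with the residual integrability supplied by
`integrable_weight_residual_sq_centreOfRecord`. MODEL statement; not NS. [folklore] -/
theorem translationMode_certified_ofRecord'
    (δ : Esp 8 eight_pos) (hball : δ ∈ closedBall (0 : Esp 8 eight_pos) (rEBR2 : ℝ))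
    (hlin : ∀ v v₁ : ℝ → ℝ, IsCompactTest v v₁ →
      linForm 8 (drift (1 / 5) centreOfRecord) (potential 8 4 centreOfRecord) (prim (der δ)) (der δ) v v₁ =
        ∫ y, ((8:ℝ) ^ 2 + y ^ 2) * ((PopFun 8 4 (1 / 5) centreOfRecord centreOfRecordDeriv δ y
          - (centreOfRecord y + 1 / 2 * y * centreOfRecordDeriv y
            + 1 / 5 * (∫ s in (0 : ℝ)..y, hilbertTransform centreOfRecord s) * centreOfRecordDeriv y
            - hilbertTransform centreOfRecord y * centreOfRecord y - deriv centreOfRecordDeriv y)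
          - QFun 8 (1 / 5) δ δ y) * v y)) :
    ∃ (Ωs₁ : ℝ → ℝ) (Hs : ℝ), IsCentre 8 (fun y => centreOfRecord y + prim (der δ) y) Ωs₁ Hs ∧
      ContDiff ℝ 3 (fun y => centreOfRecord y + prim (der δ) y) ∧
      (∀ X, deriv (fun y => centreOfRecord y + prim (der δ) y) X
          + 1 / 2 * X * deriv (deriv (fun y => centreOfRecord y + prim (der δ) y)) X
          + 1 / 5 * (hilbertTransform (fun y => centreOfRecord y + prim (der δ) y) X
              * deriv (fun y => centreOfRecord y + prim (der δ) y) X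
            + (∫ s in (0 : ℝ)..X, hilbertTransform (fun y => centreOfRecord y + prim (der δ) y) s)
              * deriv (deriv (fun y => centreOfRecord y + prim (der δ) y)) X)
          - hilbertTransform (deriv (fun y => centreOfRecord y + prim (der δ) y)) X * (centreOfRecord X + prim (der δ) X)
          - hilbertTransform (fun y => centreOfRecord y + prim (der δ) y) X * deriv (fun y => centreOfRecord y + prim (der δ) y) X
          - 1 * iteratedDeriv 2 (deriv (fun y => centreOfRecord y + prim (der δ) y)) X
        = -(1 / 2) * deriv (fun y => centreOfRecord y + prim (der δ) y) X) ∧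
      (∀ y, deriv (fun y => centreOfRecord y + prim (der δ) y) (-y) = deriv (fun y => centreOfRecord y + prim (der δ) y) y) ∧
      (Integrable fun y => ((8:ℝ) ^ 2 + y ^ 2) * deriv (fun y => centreOfRecord y + prim (der δ) y) y ^ 2) ∧
      (Integrable fun y => ((8:ℝ) ^ 2 + y ^ 2) * deriv (deriv (fun y => centreOfRecord y + prim (der δ) y)) y ^ 2) ∧
      (∫ y, deriv (fun y => centreOfRecord y + prim (der δ) y) y = 0) ∧
      ∃ X, deriv (fun y => centreOfRecord y + prim (der δ) y) X ≠ 0 :=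
  translationMode_certified_ofRecord SheetRFrameCentreResidual.integrable_weight_residual_sq_centreOfRecord δ hball hlin

/-- **THE EVEN EXISTENCE WORD FOR THE CENTRE OF RECORD ON INTERVAL SENTENCES ONLY.**  `translationMode_word_ofRecord` with `hG` supplied by
`integrable_weight_residual_sq_centreOfRecord`: modulo the (C1) pointwise datum `hC1`, the base solution operator `S₀`/`hS₀`, the capacitance inverse
with implementation 2's bounds (`hN₁ hN₂ hKNwB hepsNB`) and the residual BOUND `hηB` (`√∫ ≤ etaB2`) — there is exactly one `δ` in the `rEBR2`-ball solving
the linearised weak equation at `centreOfRecord`, and for `Ω* = centreOfRecord + prim (der δ)`: `σ = ½` IS an eigenvalue of `−DG⁺(Ω*)` (covariant gauge)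
with the non-trivial eigenvector `Ω*′ ∈ E⁺₀`.  MODEL statement; not NS. [folklore] -/
theorem translationMode_word_ofRecord'
    (hC1 : ∀ ξ, ((8:ℝ) ^ 2 + ξ ^ 2) / 2 + 1 + ξ ^ 2 / 2 + 1 / 5 * ξ * (∫ s in (0 : ℝ)..ξ, hilbertTransform centreOfRecord s)
      + (1 / 5) / 2 * ((8:ℝ) ^ 2 + ξ ^ 2) * hilbertTransform centreOfRecord ξ ≤ ((8:ℝ) ^ 2 + ξ ^ 2) * potential 8 4 centreOfRecord ξ)
    (S₀ : W 8 →L[ℝ] Esp 8 eight_pos)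
    (hS₀ : ∀ (g : W 8) (v v₁ : ℝ → ℝ), IsCompactTest v v₁ →
      linForm 8 (drift (1 / 5) centreOfRecord) (potential 8 4 centreOfRecord) (prim (der (S₀ g))) (der (S₀ g)) v v₁
        = ∫ y, ((8:ℝ) ^ 2 + y ^ 2) * ((g : ℝ → ℝ) y * v y))
    {n : ℕ} (f : Fin n → W 8) (ℓ : Fin n → Esp 8 eight_pos →L[ℝ] ℝ) (Nmat : Matrix (Fin n) (Fin n) ℝ)
    (hN₁ : (1 - capMatrix (fun i => S₀ (f i)) ℓ) * Nmat = 1) (hN₂ : Nmat * (1 - capMatrix (fun i => S₀ (f i)) ℓ) = 1)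
    (hKNwB : ∀ g : W 8, ‖capInverse (fun i => S₀ (f i)) ℓ Nmat (S₀ g)‖ ≤ (KNwB : ℝ) * ‖g‖)
    (hepsNB : ∀ u : Esp 8 eight_pos, ‖PopC eight_pos 4 (1 / 5) isCentre_centreOfRecord u - ∑ i, ℓ i u • f i‖ ≤ (epsNBR : ℝ) * ‖u‖)
    (hηB : Real.sqrt (∫ y, ((8:ℝ) ^ 2 + y ^ 2) * (centreOfRecord y + 1 / 2 * y * centreOfRecordDeriv y
      + 1 / 5 * (∫ s in (0 : ℝ)..y, hilbertTransform centreOfRecord s) * centreOfRecordDeriv y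
      - hilbertTransform centreOfRecord y * centreOfRecord y - deriv centreOfRecordDeriv y) ^ 2) ≤ (etaB2 : ℝ)) :
    ∃ δ : Esp 8 eight_pos, δ ∈ closedBall (0 : Esp 8 eight_pos) (rEBR2 : ℝ) ∧
      (∀ v v₁ : ℝ → ℝ, IsCompactTest v v₁ →
        linForm 8 (drift (1 / 5) centreOfRecord) (potential 8 4 centreOfRecord) (prim (der δ)) (der δ) v v₁ =
          ∫ y, ((8:ℝ) ^ 2 + y ^ 2) * ((PopFun 8 4 (1 / 5) centreOfRecord centreOfRecordDeriv δ y
            - (centreOfRecord y + 1 / 2 * y * centreOfRecordDeriv y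
              + 1 / 5 * (∫ s in (0 : ℝ)..y, hilbertTransform centreOfRecord s) * centreOfRecordDeriv y
              - hilbertTransform centreOfRecord y * centreOfRecord y - deriv centreOfRecordDeriv y)
            - QFun 8 (1 / 5) δ δ y) * v y)) ∧
      (∀ δ' ∈ closedBall (0 : Esp 8 eight_pos) (rEBR2 : ℝ),
        (∀ v v₁ : ℝ → ℝ, IsCompactTest v v₁ →
          linForm 8 (drift (1 / 5) centreOfRecord) (potential 8 4 centreOfRecord) (prim (der δ')) (der δ') v v₁ =
            ∫ y, ((8:ℝ) ^ 2 + y ^ 2) * ((PopFun 8 4 (1 / 5) centreOfRecord centreOfRecordDeriv δ' y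
              - (centreOfRecord y + 1 / 2 * y * centreOfRecordDeriv y
                + 1 / 5 * (∫ s in (0 : ℝ)..y, hilbertTransform centreOfRecord s) * centreOfRecordDeriv y
                - hilbertTransform centreOfRecord y * centreOfRecord y - deriv centreOfRecordDeriv y)
              - QFun 8 (1 / 5) δ' δ' y) * v y)) → δ' = δ) ∧
      ∃ (Ωs₁ : ℝ → ℝ) (Hs : ℝ), IsCentre 8 (fun y => centreOfRecord y + prim (der δ) y) Ωs₁ Hs ∧
        ContDiff ℝ 3 (fun y => centreOfRecord y + prim (der δ) y) ∧
        (∀ X, deriv (fun y => centreOfRecord y + prim (der δ) y) X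
            + 1 / 2 * X * deriv (deriv (fun y => centreOfRecord y + prim (der δ) y)) X
            + 1 / 5 * (hilbertTransform (fun y => centreOfRecord y + prim (der δ) y) X
                * deriv (fun y => centreOfRecord y + prim (der δ) y) X
              + (∫ s in (0 : ℝ)..X, hilbertTransform (fun y => centreOfRecord y + prim (der δ) y) s)
                * deriv (deriv (fun y => centreOfRecord y + prim (der δ) y)) X)
            - hilbertTransform (deriv (fun y => centreOfRecord y + prim (der δ) y)) X * (centreOfRecord X + prim (der δ) X)
            - hilbertTransform (fun y => centreOfRecord y + prim (der δ) y) X * deriv (fun y => centreOfRecord y + prim (der δ) y) X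
            - 1 * iteratedDeriv 2 (deriv (fun y => centreOfRecord y + prim (der δ) y)) X
          = -(1 / 2) * deriv (fun y => centreOfRecord y + prim (der δ) y) X) ∧
        (∀ y, deriv (fun y => centreOfRecord y + prim (der δ) y) (-y) = deriv (fun y => centreOfRecord y + prim (der δ) y) y) ∧
        (Integrable fun y => ((8:ℝ) ^ 2 + y ^ 2) * deriv (fun y => centreOfRecord y + prim (der δ) y) y ^ 2) ∧
        (Integrable fun y => ((8:ℝ) ^ 2 + y ^ 2) * deriv (deriv (fun y => centreOfRecord y + prim (der δ) y)) y ^ 2) ∧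
        (∫ y, deriv (fun y => centreOfRecord y + prim (der δ) y) y = 0) ∧
        ∃ X, deriv (fun y => centreOfRecord y + prim (der δ) y) X ≠ 0 :=
  translationMode_word_ofRecord hC1 S₀ hS₀ f ℓ Nmat hN₁ hN₂ hKNwB hepsNB
    SheetRFrameCentreResidual.integrable_weight_residual_sq_centreOfRecord hηB

end SheetRTranslationModeOfRecord
end Summit.NavierStokesRegularity.OSWSelfSimilar

end
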